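import Summits.QuantumFields.YangMills.Theorems.BalabanUVNodesN11FirstTStepO3OfIntrinsicReading

/-!
# DAG node N11 — THE WEAK FORM OF (hce₀): def-T's skew conditional expectation is CHARACTERISED by testing against bounded functions of the presented point, so the
# (O3′) obligation is «∫ piece · (f ∘ skew) dμ_in = ∫ R̃_{S₀} · f dμ_out for every bounded measurable f» — the form a Fubini ∕ change-of-variables computation delivers

HEADER — WORK-UNIT METADATA.  Cell `pub-ymgap`, YM-PLAN Track A (D-0062), seat `pub-ymgap-dag-n11-d` (g16; N11 [B14], s2), route `BalabanUVNodes`, item K1⁹ = stmt-QuantumFields-27364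
(helper lane, `--kind proof --supports 27364 --as helper`, count-neutral).  [I] = [Balaban1987RG1], [II] = [Balaban1988RG2Cluster], [III] = [Balaban1988Convergent].  Composition of
def-T's `Literature/…/T4AveragingDisintegration` (`integral_kernelTransport_mul`, `integrable_kernelTransport`, `ae_eq_of_forall_integral_mul_eq`) with this seat's p639540
`…O3OfIntrinsicReadingAtRecord13` and p640513 `…FirstTStepO3OfIntrinsicReading` (the (O3′) clause from ONE a.e. identity (hce₀) per old branch with the intrinsic reading `R̃_{S₀}`).

WHY THIS FILE.  (hce₀) `kernelTransport μ_in μ_out skew (piece_{S₀} ∘ e⁻¹) =ᵐ[μ_out] R̃_{S₀}` names def-T's conditional expectation; what a Fubini ∕ change-of-variables proof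
([I] §2 + [III] (3.10)–(3.25)) delivers is the WEAK FORM: for every bounded measurable `f` of the presented point `z = (y, v₂)`,
  (hweak)   ∫ (piece_{S₀} ∘ e⁻¹)(q) · f(skew q) dμ_in(q) = ∫ R̃_{S₀}(z) · f(z) dμ_out(z)
(print's (3.1) tested = (3.23) tested).  The kernel transport is characterised by these pairings and integrable a.e. classes are separated by bounded measurable tests, so
(hweak) ⟹ (hce₀) for ANY `dU`-integrable `ρ` and candidate `R` (§1: `R` integrable, or merely `R ≥ 0` and measurable — truncate at `{R ≤ n}`).  At the record the side conditions on
`R̃_{S₀}` are theorems of 11a's laws: the (O3′) clause asks of a §3 supplier ONE weak identity per old branch (§2); at the first step one with the old piece `w(s′)·ρ₀` (§3).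

WHAT THIS FILE PROVES (0 `def`, 0 `sorry`, standard axioms).  §1 (generic: ANY integrable `ρ`, ANY `R`) ★ `condExp_identity_of_weak` · ★★ `condExp_identity_of_weak_of_nonneg`.
§2 ★★★ `slotsTOfRecord₁₃H_succ_O3_of_hasSect2FormAtZS_of_weak_of_provisos` (Stage-13: the (O3′) disjunction from Theorem 1's level-`k` form, the core provisos, rows, and ONE WEAK
IDENTITY per old branch).  §3 ★★★ `slotsTOfRecord₁₃H_one_O3_of_weakRho_of_provisos` (the first 𝐓-step: base form discharged, old piece `w(s′)·ρ₀`, ONE weak identity).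

HONEST FRAMING.  Helper lane of K1⁹; count-neutral; two measure-theoretic lemmas + compositions BY NAME; (hweak) DISPLAYED — [I] §2 + gauge fixing + `ζ` + [III] Thm 2 ([I] Thm 1 +
[II] at the first step), NOT proved; nothing of Bałaban asserted; N11 NOT discharged; K1⁹ NOT closed, no registered stub touched; counts unmoved (typed 28∕28 · discharged 5∕27 ·
A 5∕28).  One finite `𝕋⁴_{L^K}` programme at fixed `ε = L^{−K}` — NOT ℝ⁴, NOT OS, NOT a mass gap, NOT Clay.  No `sorry`, `axiom`, `def`, `instance`, `notation`.  Sources (SHAPE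
only): [III] (2.18) p.257, (2.20)–(2.21) p.258, (3.1) p.264, (3.10)–(3.14) p.267, (3.23)–(3.25) p.270, §3 p.279, Thm 1 p.262, Thm 2 p.263; [I] Thm 1 p.258, (0.4) p.253, §2 p.267.
-/

noncomputable section

open MeasureTheory ProbabilityTheory
open scoped ENNReal NNReal BigOperators Matrix.Norms.L2Operator

namespace Summit.QuantumFields.YangMills.Theorems.BalabanUVNodesN11CondExpOfWeakIdentity

open Literature.MathematicalPhysics.QuantumFieldTheory.Balaban1983to89
open Literature.MathematicalPhysics.QuantumFieldTheory.Balaban1983to89.T4AveragingDisintegration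
open BalabanUVNodesN11O3OfIntrinsicReading (measurable_intrinsicReading_of_hgm)
open BalabanUVNodesN11O3OfIntrinsicReadingAtRecord13 (slotsTOfRecord₁₃H_succ_O3_of_hasSect2FormAtZS_of_oldBranchCondExp_of_provisos)
open BalabanUVNodesN11FirstTStepO3OfIntrinsicReading (slotsTOfRecord₁₃H_one_O3_of_condExpRho_of_provisos)
open BalabanUVNodesN11AveragingSkewPresentationAtRecord (map_prod_avOfRecord_glue_skew_absolutelyContinuous_Omega)
open BalabanUVNodesN11TStepGraphIntegrableOfProvisos (hG_at_record₁₃_of_provisos)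
open BalabanUVNodesN11TStepOldBranchGraphIntegrable (integrable_oldBranch_pieces₁₃H_of_integrable_graph tkBranchOfRecord_nonneg)
open BalabanUVNodesN11TStepBranchSumAtRecord13OfLaws (hgm_at_record₁₃_of_rows)
open N21StepWeightsPositivity (zetaOfRecord_nonneg)
open Literature.MathematicalPhysics.QuantumFieldTheory.Balaban1983to89.B14SeparationOfRecord (slotsTOfRecord_succ_eq_zero_of_init_eq_zero)
open Node00 hiding SU
open Node00.Tk T4Continuum B14.Eq218Concrete
open B10Eq42TorusConstraint (bondsIn)

variable {F : T4Family} {N : ℕ} [NeZero N]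

/-! ## §1  Generic: the weak identity characterises the skew conditional expectation (any integrable density, any candidate) -/

section Generic
/-- ★ **THE SKEW CONDITIONAL EXPECTATION FROM THE WEAK IDENTITY, candidate integrable**: for ANY `dU`-integrable `ρ` and `μ_out`-integrable `R`, if `∫ (ρ ∘ e⁻¹)·(f ∘ skew) dμ_in
= ∫ R·f dμ_out` for every bounded measurable `f`, then `kernelTransport μ_in μ_out skew (ρ ∘ e⁻¹) =ᵐ[μ_out] R`. [cite: Balaban1988Convergent, (3.1) p.264, (2.21) p.258; Balaban1987RG1, (0.4) p.253] -/
theorem condExp_identity_of_weak (ν : Stage7Numerics) (M : ℕ) (g : ℕ → ℝ) (p : B12.RunParams)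
    {k : ℕ} {hdec : DecidableEq (PBond (F.P p.K) k)} {hdec' : DecidableEq (PBond (F.P p.K) (k + 1))} (hk : k + 1 ≤ (F.P p.K).m + (F.P p.K).K)
    (s' : SeqOfRecord F ν M g p.K (k + 1)) {ρ : GaugeField (F.P p.K) k (SU N) → ℝ} (hρ : Integrable ρ (fieldMeasure (F.P p.K) k (SU N)))
    {R : ((↥(Set.toFinite (bondsIn k (s'.Ω (k + 1))ᶜ)).toFinset → SU N) × ({c : PBond (F.P p.K) (k + 1) // c ∉ (Set.toFinite (bondsIn (k + 1) (s'.Ω (k + 1))ᶜ)).toFinset} → SU N)) → ℝ}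
    (hRint : Integrable R ((Measure.pi fun _ : ↥(Set.toFinite (bondsIn k (s'.Ω (k + 1))ᶜ)).toFinset => (HaarData.haar : Measure (SU N))).prod
          (Measure.pi fun _ : {c : PBond (F.P p.K) (k + 1) // c ∉ (Set.toFinite (bondsIn (k + 1) (s'.Ω (k + 1))ᶜ)).toFinset} =>
            (HaarData.haar : Measure (SU N)))))
    (hweak : ∀ f : ((↥(Set.toFinite (bondsIn k (s'.Ω (k + 1))ᶜ)).toFinset → SU N) × ({c : PBond (F.P p.K) (k + 1) // c ∉ (Set.toFinite (bondsIn (k + 1) (s'.Ω (k + 1))ᶜ)).toFinset} → SU N)) → ℝ, Measurable f → (∃ C : ℝ, ∀ z, |f z| ≤ C) →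
      ∫ q, (ρ ∘ ⇑(MeasurableEquiv.piEquivPiSubtypeProd (fun _ : PBond (F.P p.K) k => SU N)
            (· ∈ (Set.toFinite (bondsIn k (s'.Ω (k + 1))ᶜ)).toFinset)).symm) q * f ((fun q => (q.1, fun c : {c : PBond (F.P p.K) (k + 1) // c ∉ (Set.toFinite (bondsIn (k + 1) (s'.Ω (k + 1))ᶜ)).toFinset} =>
          (avOfRecord F N p.K k).avg
            ((MeasurableEquiv.piEquivPiSubtypeProd (fun _ : PBond (F.P p.K) k => SU N)
              (· ∈ (Set.toFinite (bondsIn k (s'.Ω (k + 1))ᶜ)).toFinset)).symm q) c)) q) ∂((Measure.pi fun _ : ↥(Set.toFinite (bondsIn k (s'.Ω (k + 1))ᶜ)).toFinset => (HaarData.haar : Measure (SU N))).prod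
          (Measure.pi fun _ : {b : PBond (F.P p.K) k // b ∉ (Set.toFinite (bondsIn k (s'.Ω (k + 1))ᶜ)).toFinset} => (HaarData.haar : Measure (SU N)))) =
        ∫ z, R z * f z ∂((Measure.pi fun _ : ↥(Set.toFinite (bondsIn k (s'.Ω (k + 1))ᶜ)).toFinset => (HaarData.haar : Measure (SU N))).prod
          (Measure.pi fun _ : {c : PBond (F.P p.K) (k + 1) // c ∉ (Set.toFinite (bondsIn (k + 1) (s'.Ω (k + 1))ᶜ)).toFinset} =>
            (HaarData.haar : Measure (SU N))))) :
    kernelTransport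
        ((Measure.pi fun _ : ↥(Set.toFinite (bondsIn k (s'.Ω (k + 1))ᶜ)).toFinset => (HaarData.haar : Measure (SU N))).prod
          (Measure.pi fun _ : {b : PBond (F.P p.K) k // b ∉ (Set.toFinite (bondsIn k (s'.Ω (k + 1))ᶜ)).toFinset} => (HaarData.haar : Measure (SU N))))
        ((Measure.pi fun _ : ↥(Set.toFinite (bondsIn k (s'.Ω (k + 1))ᶜ)).toFinset => (HaarData.haar : Measure (SU N))).prod
          (Measure.pi fun _ : {c : PBond (F.P p.K) (k + 1) // c ∉ (Set.toFinite (bondsIn (k + 1) (s'.Ω (k + 1))ᶜ)).toFinset} =>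
            (HaarData.haar : Measure (SU N))))
        (fun q => (q.1, fun c : {c : PBond (F.P p.K) (k + 1) // c ∉ (Set.toFinite (bondsIn (k + 1) (s'.Ω (k + 1))ᶜ)).toFinset} =>
          (avOfRecord F N p.K k).avg
            ((MeasurableEquiv.piEquivPiSubtypeProd (fun _ : PBond (F.P p.K) k => SU N)
              (· ∈ (Set.toFinite (bondsIn k (s'.Ω (k + 1))ᶜ)).toFinset)).symm q) c))
        (ρ ∘ ⇑(MeasurableEquiv.piEquivPiSubtypeProd (fun _ : PBond (F.P p.K) k => SU N)
            (· ∈ (Set.toFinite (bondsIn k (s'.Ω (k + 1))ᶜ)).toFinset)).symm)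
      =ᵐ[((Measure.pi fun _ : ↥(Set.toFinite (bondsIn k (s'.Ω (k + 1))ᶜ)).toFinset => (HaarData.haar : Measure (SU N))).prod
          (Measure.pi fun _ : {c : PBond (F.P p.K) (k + 1) // c ∉ (Set.toFinite (bondsIn (k + 1) (s'.Ω (k + 1))ᶜ)).toFinset} =>
            (HaarData.haar : Measure (SU N))))] R := by
  have hpres := measurePreserving_piEquivPiSubtypeProd_symm_fieldMeasure (G := SU N) (Set.toFinite (bondsIn k (s'.Ω (k + 1))ᶜ)).toFinset
  have hρ' := (hpres.integrable_comp hρ.aestronglyMeasurable).mpr hρ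
  have havg := measurable_avOfRecord_glue_skew F N p.K k (Set.toFinite (bondsIn k (s'.Ω (k + 1))ᶜ)).toFinset (Set.toFinite (bondsIn (k + 1) (s'.Ω (k + 1))ᶜ)).toFinset
  have hac := map_prod_avOfRecord_glue_skew_absolutelyContinuous_Omega (F := F) (N := N) p.K s' k hk
  refine ae_eq_of_forall_integral_mul_eq (integrable_kernelTransport _ _ havg hac hρ') hRint fun f hf hC => ?_
  obtain ⟨C, hC⟩ := hC
  exact (integral_kernelTransport_mul _ _ havg hac hρ' hf hC).trans (hweak f hf ⟨C, hC⟩)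

/-- ★★ **THE SKEW CONDITIONAL EXPECTATION FROM THE WEAK IDENTITY, candidate nonnegative and measurable**: test with `f · 𝟙{R ≤ n}` — on each level set `R·𝟙` (bounded) and
`kernelTransport·𝟙` are integrable and pair identically with bounded measurable tests, so agree a.e.; the level sets exhaust. [cite: Balaban1988Convergent, (3.1) p.264, (2.21) p.258] -/
theorem condExp_identity_of_weak_of_nonneg (ν : Stage7Numerics) (M : ℕ) (g : ℕ → ℝ) (p : B12.RunParams)
    {k : ℕ} {hdec : DecidableEq (PBond (F.P p.K) k)} {hdec' : DecidableEq (PBond (F.P p.K) (k + 1))} (hk : k + 1 ≤ (F.P p.K).m + (F.P p.K).K)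
    (s' : SeqOfRecord F ν M g p.K (k + 1)) {ρ : GaugeField (F.P p.K) k (SU N) → ℝ} (hρ : Integrable ρ (fieldMeasure (F.P p.K) k (SU N)))
    {R : ((↥(Set.toFinite (bondsIn k (s'.Ω (k + 1))ᶜ)).toFinset → SU N) × ({c : PBond (F.P p.K) (k + 1) // c ∉ (Set.toFinite (bondsIn (k + 1) (s'.Ω (k + 1))ᶜ)).toFinset} → SU N)) → ℝ}
    (hR0 : ∀ z, 0 ≤ R z) (hRm : Measurable R)
    (hweak : ∀ f : ((↥(Set.toFinite (bondsIn k (s'.Ω (k + 1))ᶜ)).toFinset → SU N) × ({c : PBond (F.P p.K) (k + 1) // c ∉ (Set.toFinite (bondsIn (k + 1) (s'.Ω (k + 1))ᶜ)).toFinset} → SU N)) → ℝ, Measurable f → (∃ C : ℝ, ∀ z, |f z| ≤ C) →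
      ∫ q, (ρ ∘ ⇑(MeasurableEquiv.piEquivPiSubtypeProd (fun _ : PBond (F.P p.K) k => SU N)
            (· ∈ (Set.toFinite (bondsIn k (s'.Ω (k + 1))ᶜ)).toFinset)).symm) q * f ((fun q => (q.1, fun c : {c : PBond (F.P p.K) (k + 1) // c ∉ (Set.toFinite (bondsIn (k + 1) (s'.Ω (k + 1))ᶜ)).toFinset} =>
          (avOfRecord F N p.K k).avg
            ((MeasurableEquiv.piEquivPiSubtypeProd (fun _ : PBond (F.P p.K) k => SU N)
              (· ∈ (Set.toFinite (bondsIn k (s'.Ω (k + 1))ᶜ)).toFinset)).symm q) c)) q) ∂((Measure.pi fun _ : ↥(Set.toFinite (bondsIn k (s'.Ω (k + 1))ᶜ)).toFinset => (HaarData.haar : Measure (SU N))).prod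
          (Measure.pi fun _ : {b : PBond (F.P p.K) k // b ∉ (Set.toFinite (bondsIn k (s'.Ω (k + 1))ᶜ)).toFinset} => (HaarData.haar : Measure (SU N)))) =
        ∫ z, R z * f z ∂((Measure.pi fun _ : ↥(Set.toFinite (bondsIn k (s'.Ω (k + 1))ᶜ)).toFinset => (HaarData.haar : Measure (SU N))).prod
          (Measure.pi fun _ : {c : PBond (F.P p.K) (k + 1) // c ∉ (Set.toFinite (bondsIn (k + 1) (s'.Ω (k + 1))ᶜ)).toFinset} =>
            (HaarData.haar : Measure (SU N))))) :
    kernelTransport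
        ((Measure.pi fun _ : ↥(Set.toFinite (bondsIn k (s'.Ω (k + 1))ᶜ)).toFinset => (HaarData.haar : Measure (SU N))).prod
          (Measure.pi fun _ : {b : PBond (F.P p.K) k // b ∉ (Set.toFinite (bondsIn k (s'.Ω (k + 1))ᶜ)).toFinset} => (HaarData.haar : Measure (SU N))))
        ((Measure.pi fun _ : ↥(Set.toFinite (bondsIn k (s'.Ω (k + 1))ᶜ)).toFinset => (HaarData.haar : Measure (SU N))).prod
          (Measure.pi fun _ : {c : PBond (F.P p.K) (k + 1) // c ∉ (Set.toFinite (bondsIn (k + 1) (s'.Ω (k + 1))ᶜ)).toFinset} =>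
            (HaarData.haar : Measure (SU N))))
        (fun q => (q.1, fun c : {c : PBond (F.P p.K) (k + 1) // c ∉ (Set.toFinite (bondsIn (k + 1) (s'.Ω (k + 1))ᶜ)).toFinset} =>
          (avOfRecord F N p.K k).avg
            ((MeasurableEquiv.piEquivPiSubtypeProd (fun _ : PBond (F.P p.K) k => SU N)
              (· ∈ (Set.toFinite (bondsIn k (s'.Ω (k + 1))ᶜ)).toFinset)).symm q) c))
        (ρ ∘ ⇑(MeasurableEquiv.piEquivPiSubtypeProd (fun _ : PBond (F.P p.K) k => SU N)
            (· ∈ (Set.toFinite (bondsIn k (s'.Ω (k + 1))ᶜ)).toFinset)).symm)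
      =ᵐ[((Measure.pi fun _ : ↥(Set.toFinite (bondsIn k (s'.Ω (k + 1))ᶜ)).toFinset => (HaarData.haar : Measure (SU N))).prod
          (Measure.pi fun _ : {c : PBond (F.P p.K) (k + 1) // c ∉ (Set.toFinite (bondsIn (k + 1) (s'.Ω (k + 1))ᶜ)).toFinset} =>
            (HaarData.haar : Measure (SU N))))] R := by
  have hpres := measurePreserving_piEquivPiSubtypeProd_symm_fieldMeasure (G := SU N) (Set.toFinite (bondsIn k (s'.Ω (k + 1))ᶜ)).toFinset
  have hρ' := (hpres.integrable_comp hρ.aestronglyMeasurable).mpr hρ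
  have havg := measurable_avOfRecord_glue_skew F N p.K k (Set.toFinite (bondsIn k (s'.Ω (k + 1))ᶜ)).toFinset (Set.toFinite (bondsIn (k + 1) (s'.Ω (k + 1))ᶜ)).toFinset
  have hac := map_prod_avOfRecord_glue_skew_absolutelyContinuous_Omega (F := F) (N := N) p.K s' k hk
  have hT := integrable_kernelTransport _ _ havg hac hρ'
  set T := kernelTransport
        ((Measure.pi fun _ : ↥(Set.toFinite (bondsIn k (s'.Ω (k + 1))ᶜ)).toFinset => (HaarData.haar : Measure (SU N))).prod
          (Measure.pi fun _ : {b : PBond (F.P p.K) k // b ∉ (Set.toFinite (bondsIn k (s'.Ω (k + 1))ᶜ)).toFinset} => (HaarData.haar : Measure (SU N))))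
        ((Measure.pi fun _ : ↥(Set.toFinite (bondsIn k (s'.Ω (k + 1))ᶜ)).toFinset => (HaarData.haar : Measure (SU N))).prod
          (Measure.pi fun _ : {c : PBond (F.P p.K) (k + 1) // c ∉ (Set.toFinite (bondsIn (k + 1) (s'.Ω (k + 1))ᶜ)).toFinset} =>
            (HaarData.haar : Measure (SU N))))
        (fun q => (q.1, fun c : {c : PBond (F.P p.K) (k + 1) // c ∉ (Set.toFinite (bondsIn (k + 1) (s'.Ω (k + 1))ᶜ)).toFinset} =>
          (avOfRecord F N p.K k).avg
            ((MeasurableEquiv.piEquivPiSubtypeProd (fun _ : PBond (F.P p.K) k => SU N)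
              (· ∈ (Set.toFinite (bondsIn k (s'.Ω (k + 1))ᶜ)).toFinset)).symm q) c))
        (ρ ∘ ⇑(MeasurableEquiv.piEquivPiSubtypeProd (fun _ : PBond (F.P p.K) k => SU N)
            (· ∈ (Set.toFinite (bondsIn k (s'.Ω (k + 1))ᶜ)).toFinset)).symm) with hTdef
  -- on each level set `{R ≤ n}` the two members agree a.e.
  have hlev : ∀ n : ℕ, ∀ᵐ z ∂((Measure.pi fun _ : ↥(Set.toFinite (bondsIn k (s'.Ω (k + 1))ᶜ)).toFinset => (HaarData.haar : Measure (SU N))).prod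
          (Measure.pi fun _ : {c : PBond (F.P p.K) (k + 1) // c ∉ (Set.toFinite (bondsIn (k + 1) (s'.Ω (k + 1))ᶜ)).toFinset} =>
            (HaarData.haar : Measure (SU N)))), T z * {z | R z ≤ n}.indicator (fun _ => (1 : ℝ)) z = R z * {z | R z ≤ n}.indicator (fun _ => (1 : ℝ)) z := by
    intro n
    have hLm : MeasurableSet {z : ((↥(Set.toFinite (bondsIn k (s'.Ω (k + 1))ᶜ)).toFinset → SU N) × ({c : PBond (F.P p.K) (k + 1) // c ∉ (Set.toFinite (bondsIn (k + 1) (s'.Ω (k + 1))ᶜ)).toFinset} → SU N)) | R z ≤ n} := hRm measurableSet_Iic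
    have hind : Measurable ({z : ((↥(Set.toFinite (bondsIn k (s'.Ω (k + 1))ᶜ)).toFinset → SU N) × ({c : PBond (F.P p.K) (k + 1) // c ∉ (Set.toFinite (bondsIn (k + 1) (s'.Ω (k + 1))ᶜ)).toFinset} → SU N)) | R z ≤ n}.indicator fun _ => (1 : ℝ)) := measurable_const.indicator hLm
    have hind_bdd : ∀ z, |{z : ((↥(Set.toFinite (bondsIn k (s'.Ω (k + 1))ᶜ)).toFinset → SU N) × ({c : PBond (F.P p.K) (k + 1) // c ∉ (Set.toFinite (bondsIn (k + 1) (s'.Ω (k + 1))ᶜ)).toFinset} → SU N)) | R z ≤ n}.indicator (fun _ => (1 : ℝ)) z| ≤ 1 := fun z => by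
      by_cases hz : z ∈ {z : ((↥(Set.toFinite (bondsIn k (s'.Ω (k + 1))ᶜ)).toFinset → SU N) × ({c : PBond (F.P p.K) (k + 1) // c ∉ (Set.toFinite (bondsIn (k + 1) (s'.Ω (k + 1))ᶜ)).toFinset} → SU N)) | R z ≤ n} <;> simp [hz]
    have hRn : Integrable (fun z => R z * {z | R z ≤ n}.indicator (fun _ => (1 : ℝ)) z) ((Measure.pi fun _ : ↥(Set.toFinite (bondsIn k (s'.Ω (k + 1))ᶜ)).toFinset => (HaarData.haar : Measure (SU N))).prod
          (Measure.pi fun _ : {c : PBond (F.P p.K) (k + 1) // c ∉ (Set.toFinite (bondsIn (k + 1) (s'.Ω (k + 1))ᶜ)).toFinset} =>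
            (HaarData.haar : Measure (SU N)))) := by
      refine Integrable.of_bound (C := (n : ℝ)) ((hRm.mul hind).aestronglyMeasurable) (Filter.Eventually.of_forall fun z => ?_)
      by_cases hz : z ∈ {z : ((↥(Set.toFinite (bondsIn k (s'.Ω (k + 1))ᶜ)).toFinset → SU N) × ({c : PBond (F.P p.K) (k + 1) // c ∉ (Set.toFinite (bondsIn (k + 1) (s'.Ω (k + 1))ᶜ)).toFinset} → SU N)) | R z ≤ n}
      · have hz' : R z ≤ n := hz
        rw [Set.indicator_of_mem hz, mul_one, Real.norm_eq_abs, abs_of_nonneg (hR0 z)]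
        exact hz'
      · rw [Set.indicator_of_notMem hz, mul_zero, norm_zero]; exact Nat.cast_nonneg n
    have hTn : Integrable (fun z => T z * {z | R z ≤ n}.indicator (fun _ => (1 : ℝ)) z) ((Measure.pi fun _ : ↥(Set.toFinite (bondsIn k (s'.Ω (k + 1))ᶜ)).toFinset => (HaarData.haar : Measure (SU N))).prod
          (Measure.pi fun _ : {c : PBond (F.P p.K) (k + 1) // c ∉ (Set.toFinite (bondsIn (k + 1) (s'.Ω (k + 1))ᶜ)).toFinset} =>
            (HaarData.haar : Measure (SU N)))) :=
      hT.mul_bdd hind.aestronglyMeasurable (Filter.Eventually.of_forall fun z => by simpa [Real.norm_eq_abs] using hind_bdd z)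
    refine ae_eq_of_forall_integral_mul_eq hTn hRn fun f hf hC => ?_
    obtain ⟨C, hC⟩ := hC
    have hfi : Measurable fun z => {z | R z ≤ n}.indicator (fun _ => (1 : ℝ)) z * f z := hind.mul hf
    have hfiC : ∀ z, |{z | R z ≤ n}.indicator (fun _ => (1 : ℝ)) z * f z| ≤ C := fun z => by
      rw [abs_mul]
      calc |{z | R z ≤ n}.indicator (fun _ => (1 : ℝ)) z| * |f z| ≤ 1 * |f z| :=
            mul_le_mul_of_nonneg_right (hind_bdd z) (abs_nonneg _)
        _ ≤ C := by rw [one_mul]; exact hC z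
    have h1 := integral_kernelTransport_mul _ _ havg hac hρ' hfi hfiC
    have h2 := hweak _ hfi ⟨C, hfiC⟩
    exact (integral_congr_ae (ae_of_all _ fun z => mul_assoc _ _ _)).trans
      ((h1.trans h2).trans (integral_congr_ae (ae_of_all _ fun z => (mul_assoc _ _ _).symm)))
  rw [← ae_all_iff] at hlev
  filter_upwards [hlev] with z hz
  obtain ⟨n, hn⟩ := exists_nat_ge (R z)
  have hmem : z ∈ {z : ((↥(Set.toFinite (bondsIn k (s'.Ω (k + 1))ᶜ)).toFinset → SU N) × ({c : PBond (F.P p.K) (k + 1) // c ∉ (Set.toFinite (bondsIn (k + 1) (s'.Ω (k + 1))ᶜ)).toFinset} → SU N)) | R z ≤ n} := hn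
  have := hz n
  rw [Set.indicator_of_mem hmem, mul_one, mul_one] at this
  exact this

end Generic

/-! ## §2  Stage-13 letters at the core provisos: the (O3′) disjunction from ONE WEAK IDENTITY per old branch -/

section Stage13
/-- ★★★ **THE (O3′) DISJUNCTION OF `PresentChildObligations` FROM THEOREM 1's LEVEL-`k` FORM, THE CORE PROVISOS, ROWS, AND ONE WEAK IDENTITY PER OLD BRANCH** — p639540 with (hce₀)
from §1 (`R̃_{S₀} ≥ 0` by `WtOfRecord₁₃H_laws` ∕ `genDataOfRecord_laws` ∕ `aOp_nonneg` ∕ `tkBranchOfRecord_nonneg` ∕ `sect2Operand_pos`; measurable by p638596 over `hgm_at_record₁₃_of_rows`;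
the piece integrable by `hG_at_record₁₃_of_provisos` + p625485). [cite: Balaban1988Convergent, Thm 1 p.262, Thm 2 p.263, §3 p.279, (3.1) p.264, (3.23)–(3.25) p.270; Balaban1987RG1, (0.4) p.253] -/
theorem slotsTOfRecord₁₃H_succ_O3_of_hasSect2FormAtZS_of_weak_of_provisos (θ : Stage13HParams F N) (h : θ.Provisos₁₃CoPH F N)
    (p : B12.RunParams) {k : ℕ} (hkK : k < p.K)
    {hdec : DecidableEq (PBond (F.P p.K) k)} {hdec' : DecidableEq (PBond (F.P p.K) (k + 1))} (hk : k + 1 ≤ (F.P p.K).m + (F.P p.K).K)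
    (s' : SeqOfRecord F θ.ν θ.τ9.M (gOfRecord₁₃ F N θ.toStage13Params p) p.K (k + 1))
    {law : SeqOfRecord F θ.ν θ.τ9.M (gOfRecord₁₃ F N θ.toStage13Params p) p.K k → Sect2.TermValues (F.P p.K) (MatA N) (FluctV N) θ.τ9.M → Prop}
    {t : SeqOfRecord F θ.ν θ.τ9.M (gOfRecord₁₃ F N θ.toStage13Params p) p.K k → Sect2.TermValues (F.P p.K) (MatA N) (FluctV N) θ.τ9.M}
    {Ek : SeqOfRecord F θ.ν θ.τ9.M (gOfRecord₁₃ F N θ.toStage13Params p) p.K k → ℝ}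
    (hform : HasSect2FormAtZS F N (FluctV N) p.K (settingOfRecord₁₃ F N θ.toStage13Params p) k (θ.rzAt p) (WtOfRecord₁₃H F N θ p)
      (UbgOfRecord₁₃CoP F N θ.toStage13Params p k) law
      (slotsOfRecord F N θ.ν θ.τ9 (EOfRecord₁₃ F N θ.toStage13Params) (wOfRecord₉ F N θ.toStage9Params) θ.ppSel p (gOfRecord₁₃ F N θ.toStage13Params p) k) t Ek)
    (t' : Sect2.TermValues (F.P p.K) (MatA N) (FluctV N) θ.τ9.M) (E' : ℝ)
    (hζ0m : ∀ j Y, Measurable ((θ.zhAt p s'.init).ζ0 j Y)) (hqm : ∀ j Λ', Measurable ((θ.zhAt p s'.init).quad j Λ'))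
    (hΦ₀m : ∀ S₀ ∈ admSOfRecord F θ.ν θ.τ9.M (gOfRecord₁₃ F N θ.toStage13Params p) p.K k s'.init,
      Measurable fun ω : MultiCfg (F.P p.K) (SU N) (FluctV N) =>
        (sect2Operand F N (FluctV N) p.K (settingOfRecord₁₃ F N θ.toStage13Params p) (θ.rzAt p s'.init) s'.init (t s'.init) (Ek s'.init)
            (UbgOfRecord₁₃CoP F N θ.toStage13Params p k s'.init)) (S₀, fun j => (ω j).2) (fun j => (ω j).1))
    (hζm : ∀ j Y, Measurable ((θ.zhAt p s').ζ0 j Y)) (hqm' : ∀ j Λ', Measurable ((θ.zhAt p s').quad j Λ'))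
    (hΦm : ∀ S ∈ admSOfRecord F θ.ν θ.τ9.M (gOfRecord₁₃ F N θ.toStage13Params p) p.K (k + 1) s',
      Measurable fun ω : MultiCfg (F.P p.K) (SU N) (FluctV N) =>
        (sect2Operand F N (FluctV N) p.K (settingOfRecord₁₃ F N θ.toStage13Params p) (θ.rzAt p s') s' t' E'
                  (UbgOfRecord₁₃CoP F N θ.toStage13Params p (k + 1) s')) (S, fun j => (ω j).2) (fun j => (ω j).1))
    -- ONE WEAK IDENTITY PER OLD BRANCH
    (hweak : ∀ S₀ ∈ admSOfRecord F θ.ν θ.τ9.M (gOfRecord₁₃ F N θ.toStage13Params p) p.K k s'.init,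
      ∀ f : ((↥(Set.toFinite (bondsIn k (s'.Ω (k + 1))ᶜ)).toFinset → SU N) × ({c : PBond (F.P p.K) (k + 1) // c ∉ (Set.toFinite (bondsIn (k + 1) (s'.Ω (k + 1))ᶜ)).toFinset} → SU N)) → ℝ, Measurable f → (∃ C : ℝ, ∀ z, |f z| ≤ C) →
      ∫ q, ((fun U => wOfRecord₉ F N θ.toStage9Params p (gOfRecord₁₃ F N θ.toStage13Params p) k s' U ((avOfRecord F N p.K k).avg U) *
        (chiSeqOfRecord F N θ.ν θ.τ9.M (gOfRecord₁₃ F N θ.toStage13Params p) p.K k s'.init U *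
          tkBranchOfRecord F N (FluctV N) θ.ν θ.τ9.M (gOfRecord₁₃ F N θ.toStage13Params p) p.K (WtOfRecord₁₃H F N θ p s'.init) s'.init S₀ k (fun ω => (sect2Operand F N (FluctV N) p.K (settingOfRecord₁₃ F N θ.toStage13Params p) (θ.rzAt p s'.init) s'.init (t s'.init) (Ek s'.init)
            (UbgOfRecord₁₃CoP F N θ.toStage13Params p k s'.init)) (S₀, fun j => (ω j).2) (fun j => (ω j).1)) (baseCfg k U))) ∘
          ⇑(MeasurableEquiv.piEquivPiSubtypeProd (fun _ : PBond (F.P p.K) k => SU N)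
            (· ∈ (Set.toFinite (bondsIn k (s'.Ω (k + 1))ᶜ)).toFinset)).symm) q * f ((fun q => (q.1, fun c : {c : PBond (F.P p.K) (k + 1) // c ∉ (Set.toFinite (bondsIn (k + 1) (s'.Ω (k + 1))ᶜ)).toFinset} =>
          (avOfRecord F N p.K k).avg
            ((MeasurableEquiv.piEquivPiSubtypeProd (fun _ : PBond (F.P p.K) k => SU N)
              (· ∈ (Set.toFinite (bondsIn k (s'.Ω (k + 1))ᶜ)).toFinset)).symm q) c)) q) ∂((Measure.pi fun _ : ↥(Set.toFinite (bondsIn k (s'.Ω (k + 1))ᶜ)).toFinset => (HaarData.haar : Measure (SU N))).prod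
          (Measure.pi fun _ : {b : PBond (F.P p.K) k // b ∉ (Set.toFinite (bondsIn k (s'.Ω (k + 1))ᶜ)).toFinset} => (HaarData.haar : Measure (SU N)))) =
        ∫ z, (∑ Y ∈ (Set.toFinite {Y : Set (Site (F.P p.K) 0) | Y ∈ SClassOfRecord F θ.ν (gOfRecord₁₃ F N θ.toStage13Params p) p.K (k + 1) ∧ Y ⊆ s'.Ω (k + 1) ∩ (s'.Λ (k + 1))ᶜ}).toFinset,
          zetaOp (genDataOfRecord F N (FluctV N) θ.ν θ.τ9.M (gOfRecord₁₃ F N θ.toStage13Params p) p.K (WtOfRecord₁₃H F N θ p s') s' (Function.update S₀ (k + 1) Y) k).ζ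
            (aOp k (genDataOfRecord F N (FluctV N) θ.ν θ.τ9.M (gOfRecord₁₃ F N θ.toStage13Params p) p.K (WtOfRecord₁₃H F N θ p s') s' (Function.update S₀ (k + 1) Y) k).sA
              (genDataOfRecord F N (FluctV N) θ.ν θ.τ9.M (gOfRecord₁₃ F N θ.toStage13Params p) p.K (WtOfRecord₁₃H F N θ p s') s' (Function.update S₀ (k + 1) Y) k).w
              (tkBranchOfRecord F N (FluctV N) θ.ν θ.τ9.M (gOfRecord₁₃ F N θ.toStage13Params p) p.K (WtOfRecord₁₃H F N θ p s') s'.init S₀ k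
                (fun ω => (sect2Operand F N (FluctV N) p.K (settingOfRecord₁₃ F N θ.toStage13Params p) (θ.rzAt p s') s' t' E'
                  (UbgOfRecord₁₃CoP F N θ.toStage13Params p (k + 1) s')) (Function.update S₀ (k + 1) Y, fun j => (ω j).2) (fun j => (ω j).1))))
            (Function.update (baseCfg (k + 1) ((MeasurableEquiv.piEquivPiSubtypeProd (fun _ : PBond (F.P p.K) (k + 1) => SU N)
              (· ∈ (Set.toFinite (bondsIn (k + 1) (s'.Ω (k + 1))ᶜ)).toFinset)).symm (avgRestrOfRecord F N p.K k (Set.toFinite (bondsIn k (s'.Ω (k + 1))ᶜ)).toFinset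
                (Set.toFinite (bondsIn (k + 1) (s'.Ω (k + 1))ᶜ)).toFinset z.1, z.2))) k
            (Function.updateFinset ((baseCfg (V := FluctV N) (k + 1) ((MeasurableEquiv.piEquivPiSubtypeProd (fun _ : PBond (F.P p.K) (k + 1) => SU N)
              (· ∈ (Set.toFinite (bondsIn (k + 1) (s'.Ω (k + 1))ᶜ)).toFinset)).symm (avgRestrOfRecord F N p.K k (Set.toFinite (bondsIn k (s'.Ω (k + 1))ᶜ)).toFinset
                (Set.toFinite (bondsIn (k + 1) (s'.Ω (k + 1))ᶜ)).toFinset z.1, z.2))) k).1 (Set.toFinite (bondsIn k (s'.Ω (k + 1))ᶜ)).toFinset z.1,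
              ((baseCfg (V := FluctV N) (k + 1) ((MeasurableEquiv.piEquivPiSubtypeProd (fun _ : PBond (F.P p.K) (k + 1) => SU N)
              (· ∈ (Set.toFinite (bondsIn (k + 1) (s'.Ω (k + 1))ᶜ)).toFinset)).symm (avgRestrOfRecord F N p.K k (Set.toFinite (bondsIn k (s'.Ω (k + 1))ᶜ)).toFinset
                (Set.toFinite (bondsIn (k + 1) (s'.Ω (k + 1))ᶜ)).toFinset z.1, z.2))) k).2))) * f z ∂((Measure.pi fun _ : ↥(Set.toFinite (bondsIn k (s'.Ω (k + 1))ᶜ)).toFinset => (HaarData.haar : Measure (SU N))).prod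
          (Measure.pi fun _ : {c : PBond (F.P p.K) (k + 1) // c ∉ (Set.toFinite (bondsIn (k + 1) (s'.Ω (k + 1))ᶜ)).toFinset} =>
            (HaarData.haar : Measure (SU N))))) :
    slotsTOfRecord F N θ.ν θ.τ9 (EOfRecord₁₃ F N θ.toStage13Params) (wOfRecord₉ F N θ.toStage9Params) θ.ppSel p (gOfRecord₁₃ F N θ.toStage13Params p) (k + 1) s' = 0 ∨
      ∀ᵐ V' ∂fieldMeasure (F.P p.K) (k + 1) (SU N),
        chiSeqOfRecord F N θ.ν θ.τ9.M (gOfRecord₁₃ F N θ.toStage13Params p) p.K (k + 1) s' V' ≠ 0 →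
          slotsTOfRecord F N θ.ν θ.τ9 (EOfRecord₁₃ F N θ.toStage13Params) (wOfRecord₉ F N θ.toStage9Params) θ.ppSel p (gOfRecord₁₃ F N θ.toStage13Params p) (k + 1) s' V' =
            sect2Slot F N (FluctV N) p.K (settingOfRecord₁₃ F N θ.toStage13Params p) (θ.rzAt p s') (WtOfRecord₁₃H F N θ p s') s' t' E'
              (UbgOfRecord₁₃CoP F N θ.toStage13Params p (k + 1) s') V' := by
  rcases (hform.2 s'.init).2 with h0 | hae
  · exact Or.inl (slotsTOfRecord_succ_eq_zero_of_init_eq_zero F N θ.ν θ.τ9 _ _ θ.ppSel p _ _ s' h0)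
  -- the piece's rows are theorems of the core provisos
  have hG := hG_at_record₁₃_of_provisos θ h p hkK s'
  have hζ0 := zetaOfRecord_nonneg F N θ.ν θ.τ9.M h.zetaUnity h.zetaAbs
  have hw0 : ∀ U, 0 ≤ wOfRecord₉ F N θ.toStage9Params p (gOfRecord₁₃ F N θ.toStage13Params p) k s' U ((avOfRecord F N p.K k).avg U) :=
    fun U => wOfRecord_nonneg F N θ.ν θ.τ9.M p _ k θ.A₁ hζ0 s' U _
  have hgr : Measurable fun U : GaugeField (F.P p.K) k (SU N) => ((avOfRecord F N p.K k).avg U, U) :=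
    (avOfRecord_measurable F N p.K k).prodMk measurable_id
  have hwm : Measurable fun U => wOfRecord₉ F N θ.toStage9Params p (gOfRecord₁₃ F N θ.toStage13Params p) k s' U ((avOfRecord F N p.K k).avg U) := by
    have h' := ((h.tstep p k hkK).measW s').comp hgr
    exact h'
  have hχm : Measurable fun U => chiSeqOfRecord F N θ.ν θ.τ9.M (gOfRecord₁₃ F N θ.toStage13Params p) p.K k s'.init U :=
    measurable_chiSeqOfRecord_of_localBg (localBgMeasurable F N θ.ν) θ.τ9.M _ p.K k s'.init
  have hG₀ := integrable_oldBranch_pieces₁₃H_of_integrable_graph θ p s' t Ek hG hae h.zhLaws hw0 hwm hχm hζ0m hqm hΦ₀m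
  -- the intrinsic reading is measurable and nonnegative
  have hW := WtOfRecord₁₃H_laws h.zhLaws p s'
  have hRm := fun S₀ (h₀ : S₀ ∈ admSOfRecord F θ.ν θ.τ9.M (gOfRecord₁₃ F N θ.toStage13Params p) p.K k s'.init) =>
    measurable_intrinsicReading_of_hgm θ.ν θ.τ9.M (gOfRecord₁₃ F N θ.toStage13Params p) p (hdec := hdec) (hdec' := hdec') s' (WtOfRecord₁₃H F N θ p s')
      (sect2Operand F N (FluctV N) p.K (settingOfRecord₁₃ F N θ.toStage13Params p) (θ.rzAt p s') s' t' E'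
                  (UbgOfRecord₁₃CoP F N θ.toStage13Params p (k + 1) s')) (hgm_at_record₁₃_of_rows θ p (hdec := hdec) (hdec' := hdec') s' t' E' hζm hqm' hΦm) S₀ h₀
  have hR0 : ∀ (S₀ : ℕ → Set (Site (F.P p.K) 0)) (z : ((↥(Set.toFinite (bondsIn k (s'.Ω (k + 1))ᶜ)).toFinset → SU N) × ({c : PBond (F.P p.K) (k + 1) // c ∉ (Set.toFinite (bondsIn (k + 1) (s'.Ω (k + 1))ᶜ)).toFinset} → SU N))), 0 ≤ ∑ Y ∈ (Set.toFinite {Y : Set (Site (F.P p.K) 0) | Y ∈ SClassOfRecord F θ.ν (gOfRecord₁₃ F N θ.toStage13Params p) p.K (k + 1) ∧ Y ⊆ s'.Ω (k + 1) ∩ (s'.Λ (k + 1))ᶜ}).toFinset,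
            zetaOp (genDataOfRecord F N (FluctV N) θ.ν θ.τ9.M (gOfRecord₁₃ F N θ.toStage13Params p) p.K (WtOfRecord₁₃H F N θ p s') s' (Function.update S₀ (k + 1) Y) k).ζ
              (aOp k (genDataOfRecord F N (FluctV N) θ.ν θ.τ9.M (gOfRecord₁₃ F N θ.toStage13Params p) p.K (WtOfRecord₁₃H F N θ p s') s' (Function.update S₀ (k + 1) Y) k).sA
                (genDataOfRecord F N (FluctV N) θ.ν θ.τ9.M (gOfRecord₁₃ F N θ.toStage13Params p) p.K (WtOfRecord₁₃H F N θ p s') s' (Function.update S₀ (k + 1) Y) k).w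
                (tkBranchOfRecord F N (FluctV N) θ.ν θ.τ9.M (gOfRecord₁₃ F N θ.toStage13Params p) p.K (WtOfRecord₁₃H F N θ p s') s'.init S₀ k
                  (fun ω => (sect2Operand F N (FluctV N) p.K (settingOfRecord₁₃ F N θ.toStage13Params p) (θ.rzAt p s') s' t' E'
                    (UbgOfRecord₁₃CoP F N θ.toStage13Params p (k + 1) s')) (Function.update S₀ (k + 1) Y, fun j => (ω j).2) (fun j => (ω j).1))))
              (Function.update (baseCfg (k + 1) ((MeasurableEquiv.piEquivPiSubtypeProd (fun _ : PBond (F.P p.K) (k + 1) => SU N)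
                (· ∈ (Set.toFinite (bondsIn (k + 1) (s'.Ω (k + 1))ᶜ)).toFinset)).symm (avgRestrOfRecord F N p.K k (Set.toFinite (bondsIn k (s'.Ω (k + 1))ᶜ)).toFinset
                  (Set.toFinite (bondsIn (k + 1) (s'.Ω (k + 1))ᶜ)).toFinset z.1, z.2))) k
              (Function.updateFinset ((baseCfg (V := FluctV N) (k + 1) ((MeasurableEquiv.piEquivPiSubtypeProd (fun _ : PBond (F.P p.K) (k + 1) => SU N)
                (· ∈ (Set.toFinite (bondsIn (k + 1) (s'.Ω (k + 1))ᶜ)).toFinset)).symm (avgRestrOfRecord F N p.K k (Set.toFinite (bondsIn k (s'.Ω (k + 1))ᶜ)).toFinset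
                  (Set.toFinite (bondsIn (k + 1) (s'.Ω (k + 1))ᶜ)).toFinset z.1, z.2))) k).1 (Set.toFinite (bondsIn k (s'.Ω (k + 1))ᶜ)).toFinset z.1,
                ((baseCfg (V := FluctV N) (k + 1) ((MeasurableEquiv.piEquivPiSubtypeProd (fun _ : PBond (F.P p.K) (k + 1) => SU N)
                (· ∈ (Set.toFinite (bondsIn (k + 1) (s'.Ω (k + 1))ᶜ)).toFinset)).symm (avgRestrOfRecord F N p.K k (Set.toFinite (bondsIn k (s'.Ω (k + 1))ᶜ)).toFinset
                  (Set.toFinite (bondsIn (k + 1) (s'.Ω (k + 1))ᶜ)).toFinset z.1, z.2))) k).2)) := fun S₀ z =>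
    Finset.sum_nonneg fun Y _ => by
      rw [zetaOp_apply]
      exact mul_nonneg ((genDataOfRecord_laws F N (FluctV N) θ.ν θ.τ9.M (gOfRecord₁₃ F N θ.toStage13Params p) p.K hW s' (Function.update S₀ (k + 1) Y) k).zeta_nonneg _)
        (aOp_nonneg k _ (genDataOfRecord_laws F N (FluctV N) θ.ν θ.τ9.M (gOfRecord₁₃ F N θ.toStage13Params p) p.K hW s' (Function.update S₀ (k + 1) Y) k).w_nonneg
          (tkBranchOfRecord_nonneg θ.ν θ.τ9.M (gOfRecord₁₃ F N θ.toStage13Params p) p.K hW s'.init S₀ k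
            (fun ω => (sect2Operand_pos p.K _ _ s' t' E' _ (Function.update S₀ (k + 1) Y, fun j => (ω j).2) (fun j => (ω j).1)).le)) _)
  exact slotsTOfRecord₁₃H_succ_O3_of_hasSect2FormAtZS_of_oldBranchCondExp_of_provisos θ h p hkK (hdec := hdec) (hdec' := hdec') hk s' hform t' E'
    hζ0m hqm hΦ₀m hζm hqm' hΦm fun S₀ h₀ =>
      condExp_identity_of_weak_of_nonneg θ.ν θ.τ9.M (gOfRecord₁₃ F N θ.toStage13Params p) p (hdec := hdec) (hdec' := hdec') hk s' (hG₀ S₀ h₀) (hR0 S₀) (hRm S₀ h₀) (hweak S₀ h₀)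

end Stage13

/-! ## §3  The first 𝐓-step: ONE weak identity with the old piece `w(s′)·ρ₀` -/

section FirstStep

/-- ★★★ **THE FIRST 𝐓-STEP's (O3′) DISJUNCTION FROM ONE WEAK IDENTITY** (old piece `w(s′)·ρ₀`, Theorem 1's base form discharged): p640513's `…_of_condExpRho_of_provisos` with
(hce) from §1 — `∫ dμ_in (w(s′)·ρ₀ ∘ e⁻¹)·(f ∘ skew) = ∫ dμ_out R̃_∅·f` for every bounded measurable `f`: [I] Thm 1 + [II] tested against functions of `(U|_{Ω₁ᶜ}, Ū|_{Ω₁})`; the graph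
is `dU`-integrable under the provisos (`χ_0 ≡ 1`), `R̃_∅ ≥ 0` and measurable (`admSOfRecord_zero`, `𝐓_0 = 1`). [cite: Balaban1988Convergent, Thm 1 p.262, (3.1) p.264, (3.23)–(3.25) p.270; Balaban1987RG1, Thm 1 p.258] -/
theorem slotsTOfRecord₁₃H_one_O3_of_weakRho_of_provisos (θ : Stage13HParams F N) (h : θ.Provisos₁₃CoPH F N) (p : B12.RunParams) (hK : 0 < p.K)
    {hdec : DecidableEq (PBond (F.P p.K) 0)} {hdec' : DecidableEq (PBond (F.P p.K) 1)}
    (s' : SeqOfRecord F θ.ν θ.τ9.M (gOfRecord₁₃ F N θ.toStage13Params p) p.K 1)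
    (u₁ : Sect2.TermValues (F.P p.K) (MatA N) (FluctV N) θ.τ9.M) (e₁ : ℝ)
    (hζ0m : ∀ j Y, Measurable ((θ.zhAt p s'.init).ζ0 j Y)) (hqm : ∀ j Λ', Measurable ((θ.zhAt p s'.init).quad j Λ'))
    (hζm : ∀ j Y, Measurable ((θ.zhAt p s').ζ0 j Y)) (hqm' : ∀ j Λ', Measurable ((θ.zhAt p s').quad j Λ'))
    (hΦm : ∀ S ∈ admSOfRecord F θ.ν θ.τ9.M (gOfRecord₁₃ F N θ.toStage13Params p) p.K 1 s',
      Measurable fun ω : MultiCfg (F.P p.K) (SU N) (FluctV N) =>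
        (sect2Operand F N (FluctV N) p.K (settingOfRecord₁₃ F N θ.toStage13Params p) (θ.rzAt p s') s' u₁ e₁
                  (UbgOfRecord₁₃CoP F N θ.toStage13Params p 1 s')) (S, fun j => (ω j).2) (fun j => (ω j).1))
    -- THE ONE WEAK IDENTITY
    (hweak : ∀ f : ((↥(Set.toFinite (bondsIn 0 (s'.Ω 1)ᶜ)).toFinset → SU N) × ({c : PBond (F.P p.K) 1 // c ∉ (Set.toFinite (bondsIn 1 (s'.Ω 1)ᶜ)).toFinset} → SU N)) → ℝ, Measurable f → (∃ C : ℝ, ∀ z, |f z| ≤ C) →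
      ∫ q, ((fun U => wOfRecord₉ F N θ.toStage9Params p (gOfRecord₁₃ F N θ.toStage13Params p) 0 s' U ((avOfRecord F N p.K 0).avg U) *
            slotsOfRecord F N θ.ν θ.τ9 (EOfRecord₁₃ F N θ.toStage13Params) (wOfRecord₉ F N θ.toStage9Params) θ.ppSel p (gOfRecord₁₃ F N θ.toStage13Params p) 0 s'.init U) ∘
          ⇑(MeasurableEquiv.piEquivPiSubtypeProd (fun _ : PBond (F.P p.K) 0 => SU N)
            (· ∈ (Set.toFinite (bondsIn 0 (s'.Ω 1)ᶜ)).toFinset)).symm) q * f ((fun q => (q.1, fun c : {c : PBond (F.P p.K) 1 // c ∉ (Set.toFinite (bondsIn 1 (s'.Ω 1)ᶜ)).toFinset} =>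
          (avOfRecord F N p.K 0).avg
            ((MeasurableEquiv.piEquivPiSubtypeProd (fun _ : PBond (F.P p.K) 0 => SU N)
              (· ∈ (Set.toFinite (bondsIn 0 (s'.Ω 1)ᶜ)).toFinset)).symm q) c)) q) ∂((Measure.pi fun _ : ↥(Set.toFinite (bondsIn 0 (s'.Ω 1)ᶜ)).toFinset => (HaarData.haar : Measure (SU N))).prod
          (Measure.pi fun _ : {b : PBond (F.P p.K) 0 // b ∉ (Set.toFinite (bondsIn 0 (s'.Ω 1)ᶜ)).toFinset} => (HaarData.haar : Measure (SU N)))) =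
        ∫ z, (∑ Y ∈ (Set.toFinite {Y : Set (Site (F.P p.K) 0) | Y ∈ SClassOfRecord F θ.ν (gOfRecord₁₃ F N θ.toStage13Params p) p.K 1 ∧ Y ⊆ s'.Ω 1 ∩ (s'.Λ 1)ᶜ}).toFinset,
          zetaOp (genDataOfRecord F N (FluctV N) θ.ν θ.τ9.M (gOfRecord₁₃ F N θ.toStage13Params p) p.K (WtOfRecord₁₃H F N θ p s') s' (Function.update (fun _ => ∅) 1 Y) 0).ζ
            (aOp 0 (genDataOfRecord F N (FluctV N) θ.ν θ.τ9.M (gOfRecord₁₃ F N θ.toStage13Params p) p.K (WtOfRecord₁₃H F N θ p s') s' (Function.update (fun _ => ∅) 1 Y) 0).sA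
              (genDataOfRecord F N (FluctV N) θ.ν θ.τ9.M (gOfRecord₁₃ F N θ.toStage13Params p) p.K (WtOfRecord₁₃H F N θ p s') s' (Function.update (fun _ => ∅) 1 Y) 0).w
              (fun ω => (sect2Operand F N (FluctV N) p.K (settingOfRecord₁₃ F N θ.toStage13Params p) (θ.rzAt p s') s' u₁ e₁
                  (UbgOfRecord₁₃CoP F N θ.toStage13Params p 1 s')) (Function.update (fun _ => ∅) 1 Y, fun j => (ω j).2) (fun j => (ω j).1)))
            (Function.update (baseCfg 1 ((MeasurableEquiv.piEquivPiSubtypeProd (fun _ : PBond (F.P p.K) 1 => SU N)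
              (· ∈ (Set.toFinite (bondsIn 1 (s'.Ω 1)ᶜ)).toFinset)).symm (avgRestrOfRecord F N p.K 0 (Set.toFinite (bondsIn 0 (s'.Ω 1)ᶜ)).toFinset
                (Set.toFinite (bondsIn 1 (s'.Ω 1)ᶜ)).toFinset z.1, z.2))) 0
            (Function.updateFinset ((baseCfg (V := FluctV N) 1 ((MeasurableEquiv.piEquivPiSubtypeProd (fun _ : PBond (F.P p.K) 1 => SU N)
              (· ∈ (Set.toFinite (bondsIn 1 (s'.Ω 1)ᶜ)).toFinset)).symm (avgRestrOfRecord F N p.K 0 (Set.toFinite (bondsIn 0 (s'.Ω 1)ᶜ)).toFinset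
                (Set.toFinite (bondsIn 1 (s'.Ω 1)ᶜ)).toFinset z.1, z.2))) 0).1 (Set.toFinite (bondsIn 0 (s'.Ω 1)ᶜ)).toFinset z.1,
              ((baseCfg (V := FluctV N) 1 ((MeasurableEquiv.piEquivPiSubtypeProd (fun _ : PBond (F.P p.K) 1 => SU N)
              (· ∈ (Set.toFinite (bondsIn 1 (s'.Ω 1)ᶜ)).toFinset)).symm (avgRestrOfRecord F N p.K 0 (Set.toFinite (bondsIn 0 (s'.Ω 1)ᶜ)).toFinset
                (Set.toFinite (bondsIn 1 (s'.Ω 1)ᶜ)).toFinset z.1, z.2))) 0).2))) * f z ∂((Measure.pi fun _ : ↥(Set.toFinite (bondsIn 0 (s'.Ω 1)ᶜ)).toFinset => (HaarData.haar : Measure (SU N))).prod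
          (Measure.pi fun _ : {c : PBond (F.P p.K) 1 // c ∉ (Set.toFinite (bondsIn 1 (s'.Ω 1)ᶜ)).toFinset} =>
            (HaarData.haar : Measure (SU N))))) :
    slotsTOfRecord F N θ.ν θ.τ9 (EOfRecord₁₃ F N θ.toStage13Params) (wOfRecord₉ F N θ.toStage9Params) θ.ppSel p (gOfRecord₁₃ F N θ.toStage13Params p) 1 s' = 0 ∨
      ∀ᵐ V' ∂fieldMeasure (F.P p.K) 1 (SU N),
        chiSeqOfRecord F N θ.ν θ.τ9.M (gOfRecord₁₃ F N θ.toStage13Params p) p.K 1 s' V' ≠ 0 →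
          slotsTOfRecord F N θ.ν θ.τ9 (EOfRecord₁₃ F N θ.toStage13Params) (wOfRecord₉ F N θ.toStage9Params) θ.ppSel p (gOfRecord₁₃ F N θ.toStage13Params p) 1 s' V' =
            sect2Slot F N (FluctV N) p.K (settingOfRecord₁₃ F N θ.toStage13Params p) (θ.rzAt p s') (WtOfRecord₁₃H F N θ p s') s' u₁ e₁
              (UbgOfRecord₁₃CoP F N θ.toStage13Params p 1 s') V' := by
  have hk : 0 + 1 ≤ (F.P p.K).m + (F.P p.K).K := by show 0 + 1 ≤ F.m + p.K; omega
  -- the graph `w(s′)·χ_0·ρ₀ = w(s′)·ρ₀` is `dU`-integrable under the core provisos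
  have hG := hG_at_record₁₃_of_provisos θ h p hK s'
  have h1 : (fun U => wOfRecord₉ F N θ.toStage9Params p (gOfRecord₁₃ F N θ.toStage13Params p) 0 s' U ((avOfRecord F N p.K 0).avg U) *
        slotsOfRecord F N θ.ν θ.τ9 (EOfRecord₁₃ F N θ.toStage13Params) (wOfRecord₉ F N θ.toStage9Params) θ.ppSel p (gOfRecord₁₃ F N θ.toStage13Params p) 0 s'.init U) =
      fun U => wOfRecord₉ F N θ.toStage9Params p (gOfRecord₁₃ F N θ.toStage13Params p) 0 s' U ((avOfRecord F N p.K 0).avg U) *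
        (chiSeqOfRecord F N θ.ν θ.τ9.M (gOfRecord₁₃ F N θ.toStage13Params p) p.K 0 s'.init U *
          slotsOfRecord F N θ.ν θ.τ9 (EOfRecord₁₃ F N θ.toStage13Params) (wOfRecord₉ F N θ.toStage9Params) θ.ppSel p (gOfRecord₁₃ F N θ.toStage13Params p) 0 s'.init U) := by
    funext U; rw [chiSeqOfRecord_zero, one_mul]
  rw [← h1] at hG
  -- the intrinsic reading at the first step is measurable and nonnegative (`admSOfRecord_zero`, `𝐓_0 = 1`)
  have hW := WtOfRecord₁₃H_laws h.zhLaws p s'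
  have hmem : (fun _ => (∅ : Set (Site (F.P p.K) 0))) ∈ admSOfRecord F θ.ν θ.τ9.M (gOfRecord₁₃ F N θ.toStage13Params p) p.K 0 s'.init := by
    rw [admSOfRecord_zero, Finset.mem_singleton]
  have hRm := measurable_intrinsicReading_of_hgm θ.ν θ.τ9.M (gOfRecord₁₃ F N θ.toStage13Params p) p (hdec := hdec) (hdec' := hdec') s' (WtOfRecord₁₃H F N θ p s')
      (sect2Operand F N (FluctV N) p.K (settingOfRecord₁₃ F N θ.toStage13Params p) (θ.rzAt p s') s' u₁ e₁
                  (UbgOfRecord₁₃CoP F N θ.toStage13Params p 1 s')) (hgm_at_record₁₃_of_rows θ p (hdec := hdec) (hdec' := hdec') s' u₁ e₁ hζm hqm' hΦm) _ hmem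
  have hR0 : ∀ z : ((↥(Set.toFinite (bondsIn 0 (s'.Ω 1)ᶜ)).toFinset → SU N) × ({c : PBond (F.P p.K) 1 // c ∉ (Set.toFinite (bondsIn 1 (s'.Ω 1)ᶜ)).toFinset} → SU N)), 0 ≤ ∑ Y ∈ (Set.toFinite {Y : Set (Site (F.P p.K) 0) | Y ∈ SClassOfRecord F θ.ν (gOfRecord₁₃ F N θ.toStage13Params p) p.K 1 ∧ Y ⊆ s'.Ω 1 ∩ (s'.Λ 1)ᶜ}).toFinset,
            zetaOp (genDataOfRecord F N (FluctV N) θ.ν θ.τ9.M (gOfRecord₁₃ F N θ.toStage13Params p) p.K (WtOfRecord₁₃H F N θ p s') s' (Function.update (fun _ => ∅) 1 Y) 0).ζ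
              (aOp 0 (genDataOfRecord F N (FluctV N) θ.ν θ.τ9.M (gOfRecord₁₃ F N θ.toStage13Params p) p.K (WtOfRecord₁₃H F N θ p s') s' (Function.update (fun _ => ∅) 1 Y) 0).sA
                (genDataOfRecord F N (FluctV N) θ.ν θ.τ9.M (gOfRecord₁₃ F N θ.toStage13Params p) p.K (WtOfRecord₁₃H F N θ p s') s' (Function.update (fun _ => ∅) 1 Y) 0).w
                (fun ω => (sect2Operand F N (FluctV N) p.K (settingOfRecord₁₃ F N θ.toStage13Params p) (θ.rzAt p s') s' u₁ e₁
                    (UbgOfRecord₁₃CoP F N θ.toStage13Params p 1 s')) (Function.update (fun _ => ∅) 1 Y, fun j => (ω j).2) (fun j => (ω j).1)))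
              (Function.update (baseCfg 1 ((MeasurableEquiv.piEquivPiSubtypeProd (fun _ : PBond (F.P p.K) 1 => SU N)
                (· ∈ (Set.toFinite (bondsIn 1 (s'.Ω 1)ᶜ)).toFinset)).symm (avgRestrOfRecord F N p.K 0 (Set.toFinite (bondsIn 0 (s'.Ω 1)ᶜ)).toFinset
                  (Set.toFinite (bondsIn 1 (s'.Ω 1)ᶜ)).toFinset z.1, z.2))) 0
              (Function.updateFinset ((baseCfg (V := FluctV N) 1 ((MeasurableEquiv.piEquivPiSubtypeProd (fun _ : PBond (F.P p.K) 1 => SU N)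
                (· ∈ (Set.toFinite (bondsIn 1 (s'.Ω 1)ᶜ)).toFinset)).symm (avgRestrOfRecord F N p.K 0 (Set.toFinite (bondsIn 0 (s'.Ω 1)ᶜ)).toFinset
                  (Set.toFinite (bondsIn 1 (s'.Ω 1)ᶜ)).toFinset z.1, z.2))) 0).1 (Set.toFinite (bondsIn 0 (s'.Ω 1)ᶜ)).toFinset z.1,
                ((baseCfg (V := FluctV N) 1 ((MeasurableEquiv.piEquivPiSubtypeProd (fun _ : PBond (F.P p.K) 1 => SU N)
                (· ∈ (Set.toFinite (bondsIn 1 (s'.Ω 1)ᶜ)).toFinset)).symm (avgRestrOfRecord F N p.K 0 (Set.toFinite (bondsIn 0 (s'.Ω 1)ᶜ)).toFinset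
                  (Set.toFinite (bondsIn 1 (s'.Ω 1)ᶜ)).toFinset z.1, z.2))) 0).2)) := fun z =>
    Finset.sum_nonneg fun Y _ => by
      rw [zetaOp_apply]
      exact mul_nonneg ((genDataOfRecord_laws F N (FluctV N) θ.ν θ.τ9.M (gOfRecord₁₃ F N θ.toStage13Params p) p.K hW s' (Function.update (fun _ => ∅) 1 Y) 0).zeta_nonneg _)
        (aOp_nonneg 0 _ (genDataOfRecord_laws F N (FluctV N) θ.ν θ.τ9.M (gOfRecord₁₃ F N θ.toStage13Params p) p.K hW s' (Function.update (fun _ => ∅) 1 Y) 0).w_nonneg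
          (fun ω => (sect2Operand_pos p.K _ _ s' u₁ e₁ _ (Function.update (fun _ => ∅) 1 Y, fun j => (ω j).2) (fun j => (ω j).1)).le) _)
  exact slotsTOfRecord₁₃H_one_O3_of_condExpRho_of_provisos θ h p hK (hdec := hdec) (hdec' := hdec') s' u₁ e₁ hζ0m hqm hζm hqm' hΦm
    (condExp_identity_of_weak_of_nonneg θ.ν θ.τ9.M (gOfRecord₁₃ F N θ.toStage13Params p) p (hdec := hdec) (hdec' := hdec') hk s' hG hR0 hRm hweak)

end FirstStep

end Summit.QuantumFields.YangMills.Theorems.BalabanUVNodesN11CondExpOfWeakIdentity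

end
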